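import Summits.HodgeConjecture.HodgeConjecture.Theorems.H413SpectrumJunction
import Literature.NumberTheory.Automorphic.AutomorphicSpectrum
import HarnessLib

/-!
# Crux `H413`, (D) desk sub-line `F0_P2SpectralProjectionD` — stub (G) `stub_G_holGermOfWeak`: HOLOMORPHIC GERMS FROM WEAK (`L²`) CAUCHY–RIEMANN

Cell hodgecm-mathlib (D-0151), FLOOR 0, crux item H413 = stmt-HodgeConjecture-24833; programme P2, sub-line of record
`Cruxes/H413/Lines/F0_P2SpectralProjectionD.lean` v1.1 (F0P2-plan (g2), e1fa5bd1; road (h) «holomorphic reproduction» of `F0/P2/CENSUS-R.v2`),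
registered stub **(G) `stub_G_holGermOfWeak : StubGHolGermOfWeak`** (:281 ∕ :333), assigned to F0P2-p01 (g2) (bus 2026-08-31T00:03:40Z).  THEOREMS ONLY; `--supports
stmt-HodgeConjecture-24833 --as helper`.  HC_CM is proved only modulo the 7 printed citations until rung 0 closes; this file proves nothing about them.

THE STATEMENT (the Lines-local bundles `Realises` ∕ `IsWeaklyHol` ∕ `probeP` ∕ `orbitP` UNFOLDED into their fields, since a `Theorems/` file cannot import a `Cruxes/…/Lines/`
module; stated for ANY adelic group datum `𝒢`, any archimedean section `ιinf : U(2,1) →* G(𝔸)` and any automorphic measure — the sub-line instantiates at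
`(G3 L H, cmArchSection L ι H T hT)`): if each scalar `Ψ_j : G(𝔸) → ℂ` is left-`A_G·G(K)`-invariant and continuous, its `𝔭`-probes `b ↦ Ψ_j (y · ιinf (exp X_b))`
are differentiable at `0` for every `y` with probe derivatives CONTINUOUS in `y` and REPRESENTING (on the quotient, a.e.) the `L²`-derivatives of the `𝔭`-orbit map of a class
`w_j`, and `w_j` is WEAKLY holomorphic (its `L²` orbit differential at `0` is `ℂ`-linear), then `x ↦ (Ψ_0 x, Ψ_1 x)` has holomorphic germs along `ιinf`
(`CotangentForms.IsHolGerm`): the Cauchy–Riemann defect `y ↦ ∂Ψ_j(y)(I b) − I ∂Ψ_j(y)(b)` is continuous and left-invariant, its descent to the quotient is continuous (★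
`SpectrumJunction.continuous_toQuotFun`) and vanishes a.e. (it represents `D_j(I b) − I D_j(b) = 0`), hence everywhere because an automorphic measure charges every
non-empty open set (Mathlib `Continuous.ae_eq_iff_eq`).  [Borel1997, §5.14] (holomorphy read on the group); [BorelWallach2000, VII 2.10].

* `isHolGerm_of_weaklyHol` — the stub with unfolded hypotheses (registrar's fold: `stub_G_holGermOfWeak := fun L _ _ _ ι H T hT μ _ w Ψ hR hW =>
  P2StubGHolGermOfWeak.isHolGerm_of_weaklyHol (G3 L H) μ (cmArchSection L ι H T hT) w Ψ (fun j => (hR j).leftInv) (fun j => (hR j).diff)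
  (fun j => (hR j).contDeriv) (fun j => (hR j).derivAe) hW`).

## References
* [Borel1997] A. Borel, *Automorphic forms on SL₂(ℝ)* (1997), §5.14, Thm. 2.13.  [BorelWallach2000] VII 2.10.  [BorelJacquet1979] §4.2, §4.6.
-/

set_option autoImplicit false

-- the mandated namespace has the single-problem summit's repeated segment (`HodgeConjecture.HodgeConjecture`)
set_option linter.dupNamespace false

noncomputable section

namespace Summit.HodgeConjecture.HodgeConjecture.Cruxes.H413.P2StubGHolGermOfWeak

open MeasureTheory NumberField
open Literature.NumberTheory.Automorphic Literature.NumberTheory.Automorphic.UnitaryGroup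
open Literature.NumberTheory.Automorphic.UnitaryGroup.CotangentForms
open Literature.AlgebraicGeometry.ShimuraVarieties
open Literature.Geometry.ComplexHyperbolic.BallModel (U21)
open Summit.HodgeConjecture.HodgeConjecture.Cruxes.H413.SpectrumJunction (continuous_toQuotFun)

variable {K : Type} [Field K] [NumberField K] (𝒢 : AdelicGroupData.{0} K)
  (μ : Measure 𝒢.automorphicQuotient) [𝒢.IsAutomorphicMeasure μ] (ιinf : U21 →* 𝒢.Adelic)

/-- **A continuous left-invariant function whose descent vanishes a.e. vanishes everywhere** (an automorphic measure charges every non-empty open set; ★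
`continuous_toQuotFun`, Mathlib `Continuous.ae_eq_iff_eq`, `toQuotFun_mk`). [cite: BorelJacquet1979, §4.2] -/
theorem eq_zero_of_toQuotFun_ae_eq_zero {E : 𝒢.Adelic → ℂ} (hleft : ∀ γ ∈ 𝒢.quotientSubgroup, ∀ x, E (γ * x) = E x) (hcont : Continuous E)
    (hae : toQuotFun 𝒢 E =ᵐ[μ] 0) : E = 0 := by
  have hq : toQuotFun 𝒢 E = 0 :=
    (Continuous.ae_eq_iff_eq μ (continuous_toQuotFun hleft hcont) continuous_const).mp hae
  funext x
  have h := congrFun hq (𝒢.toAutomorphicQuotient x⁻¹)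
  rw [toQuotFun_mk hleft, inv_inv] at h
  exact h

/-- **STUB (G) — HOLOMORPHIC GERMS FROM WEAK CAUCHY–RIEMANN** (the registered `StubGHolGermOfWeak` with the Lines-local bundles `Realises`∕`IsWeaklyHol` unfolded into their fields):
the vector function `x ↦ (Ψ_0 x, Ψ_1 x)` has holomorphic germs along `ιinf` as soon as each `Ψ_j` is a left-invariant function with everywhere-differentiable `𝔭`-probes whose (continuity of `Ψ_j` itself, `Realises.cont`, is NOT needed)
derivatives are continuous in the base point and represent the `L²`-derivatives of the `𝔭`-orbit map of a WEAKLY holomorphic class `w_j`.  Proof: the CR defect of `Ψ_j` in a direction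
`b` is continuous, left-invariant, and its descent represents `D_j(I b) − I D_j(b) = 0`; by `eq_zero_of_toQuotFun_ae_eq_zero` it vanishes identically.
[cite: Borel1997, §5.14] [cite: BorelWallach2000, VII 2.10] -/
theorem isHolGerm_of_weaklyHol (w : Fin 2 → 𝒢.L2 μ) (Ψ : Fin 2 → (𝒢.Adelic → ℂ))
    (hleft : ∀ j, ∀ γ ∈ 𝒢.quotientSubgroup, ∀ x, Ψ j (γ * x) = Ψ j x)
    (hdiff : ∀ j (y : 𝒢.Adelic), DifferentiableAt ℝ (fun b : Fin 2 → ℂ => Ψ j (y * ιinf (BallForms.expP b))) 0)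
    (hcontD : ∀ (j : Fin 2) (b : Fin 2 → ℂ), Continuous fun y => fderiv ℝ (fun b : Fin 2 → ℂ => Ψ j (y * ιinf (BallForms.expP b))) 0 b)
    (hderivAe : ∀ (j : Fin 2) (b : Fin 2 → ℂ),
      toQuotFun 𝒢 (fun y => fderiv ℝ (fun b : Fin 2 → ℂ => Ψ j (y * ιinf (BallForms.expP b))) 0 b) =ᵐ[μ]
        ((fderiv ℝ (fun b : Fin 2 → ℂ => 𝒢.rightRegular μ (ιinf (BallForms.expP b)) (w j)) 0 b : 𝒢.L2 μ) : 𝒢.automorphicQuotient → ℂ))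
    (hweak : ∀ (j : Fin 2) (b : Fin 2 → ℂ),
      fderiv ℝ (fun b : Fin 2 → ℂ => 𝒢.rightRegular μ (ιinf (BallForms.expP b)) (w j)) 0 (Complex.I • b) =
        Complex.I • fderiv ℝ (fun b : Fin 2 → ℂ => 𝒢.rightRegular μ (ιinf (BallForms.expP b)) (w j)) 0 b) :
    IsHolGerm ιinf (fun x j => Ψ j x) := by
  -- the probe of the vector function is the tuple of the scalar probes
  have hpi : ∀ y : 𝒢.Adelic, HasFDerivAt (germAt ιinf (fun x j => Ψ j x) y)
      (ContinuousLinearMap.pi fun j => fderiv ℝ (fun b : Fin 2 → ℂ => Ψ j (y * ιinf (BallForms.expP b))) 0) 0 := by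
    intro y
    exact hasFDerivAt_pi.mpr fun j => (hdiff j y).hasFDerivAt
  refine ⟨fun y => (hpi y).differentiableAt, fun y v => ?_⟩
  rw [(hpi y).fderiv]
  funext j
  rw [ContinuousLinearMap.pi_apply, Pi.smul_apply, ContinuousLinearMap.pi_apply]
  -- the CR defect of `Ψ_j` in direction `v`, as a function of the base point
  set E : 𝒢.Adelic → ℂ := fun y =>
    fderiv ℝ (fun b : Fin 2 → ℂ => Ψ j (y * ιinf (BallForms.expP b))) 0 (Complex.I • v) -
      Complex.I • fderiv ℝ (fun b : Fin 2 → ℂ => Ψ j (y * ιinf (BallForms.expP b))) 0 v with hE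
  have hEleft : ∀ γ ∈ 𝒢.quotientSubgroup, ∀ x, E (γ * x) = E x := by
    intro γ hγ x
    have hfun : (fun b : Fin 2 → ℂ => Ψ j (γ * x * ιinf (BallForms.expP b))) = fun b => Ψ j (x * ιinf (BallForms.expP b)) := by
      funext b; rw [mul_assoc, hleft j γ hγ]
    simp only [hE, hfun]
  have hEcont : Continuous E := ((hcontD j (Complex.I • v)).sub ((hcontD j v).const_smul Complex.I))
  have hEae : toQuotFun 𝒢 E =ᵐ[μ] 0 := by
    have h1 := hderivAe j (Complex.I • v)
    have h2 := hderivAe j v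
    have h3 := Lp.coeFn_smul Complex.I
      (fderiv ℝ (fun b : Fin 2 → ℂ => 𝒢.rightRegular μ (ιinf (BallForms.expP b)) (w j)) 0 v : 𝒢.L2 μ)
    rw [← hweak j v] at h3
    filter_upwards [h1, h2, h3] with z hz1 hz2 hz3
    -- `toQuotFun` is evaluation at a representative, hence commutes with the pointwise operations
    have hq : toQuotFun 𝒢 E z = toQuotFun 𝒢 (fun y => fderiv ℝ (fun b : Fin 2 → ℂ => Ψ j (y * ιinf (BallForms.expP b))) 0 (Complex.I • v)) z -
        Complex.I • toQuotFun 𝒢 (fun y => fderiv ℝ (fun b : Fin 2 → ℂ => Ψ j (y * ιinf (BallForms.expP b))) 0 v) z := rfl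
    rw [hq, hz1, hz2, hz3, Pi.smul_apply, sub_self, Pi.zero_apply]
  have hE0 : E = 0 := eq_zero_of_toQuotFun_ae_eq_zero 𝒢 μ hEleft hEcont hEae
  have := congrFun hE0 y
  simp only [hE, Pi.zero_apply, sub_eq_zero] at this
  exact this

end Summit.HodgeConjecture.HodgeConjecture.Cruxes.H413.P2StubGHolGermOfWeak

end
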